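import Mathlib
import HarnessLib

/-!
# `AlphaInputsT3ACv3AbelianShapes1D` — STRATEGY B for 2′, (LL) the linear regional lift: THE ONE-DIMENSIONAL SHAPE SYSTEM — a bond profile hosted in one block with its
# cumulative, the crossing-bond and block indicators, as periodic functions of the cyclic offset; difference relations, vanishing block sums, supports, bounds — lane
# `pub-balaban3d`, seat alpha-2 (g5)

WHY.  The exact finest lift of a coarse one-form with `L^{−2k}`-small curls (sibling `…v3AbelianRegionalLift`) is the NAIVE crossing-bond lift corrected by tensor products of
one-dimensional shapes.  Along one axis, with `n = L^k` finest sites per block and period `N = n·n_c` (`n_c ≥ 2` coarse sites), all shapes are functions of the cyclic offset `ρ`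
from the start of the home block: the crossing bond `c(ρ) = [ρ ≡ n−1]`, the block `b(ρ) = [ρ mod N < n]`, the bond profile `h⁰(ρ) = (6ρ − 2(n−2))/(n(n+1))` on the home block
(hosted-0) with cumulative `g⁰(ρ) = Σ_{r<ρ} h⁰(r) = ρ(3ρ−2n+1)/(n(n+1))`, and the mirrored profile hosted in the NEXT block (`h¹`, `g¹`).  THIS FILE: the profiles and closed
forms (§1), the periodic shapes (§2), ★ the three difference relations `g(ρ+1) − g(ρ) = h(ρ) − c(ρ)` (both hostings) and `b(ρ+1) − b(ρ) = c(ρ+n) − c(ρ)` (§3), ★ the vanishing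
block sums `Σ_{j<n} g(nb+j) = 0` (this is what makes every corrector invisible to the tube average), `Σ_{j<n} b(nb+j) = n·[b ≡ 0]`, `Σ_{s<n} c(t+s) = b(t)` (§4), supports (§5)
and the bounds `|h| ≤ 4/n`, `|g| ≤ 1` (§6).  Pure arithmetic; no lattice objects.
HONEST FRAMING.  Elementary real arithmetic; nothing of [B10]∕[7]∕[4] asserted; count-neutral helper toward R3 2′ (`stub_laneRecordsV3`, items 19935∕19936); registry untouched;
nothing about d = 4, the continuum, or a mass gap.

References: T. Bałaban, Commun. Math. Phys. 102 (1985) 277–309 [Balaban1985Variational] ((8) p.279: the space of exact-average configurations these shapes serve);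
CMP 109 (1987) 249–301 [Balaban1987RG1] ((0.4) p.253).
-/

set_option autoImplicit false

noncomputable section

namespace Summit.QuantumFields.YangMills.Theorems.AbelianEML.Shapes1D

open scoped BigOperators

/-! ## §1 The hosted bond profile and its cumulative -/

/-- **THE BOND PROFILE** `h(r) = (6r − 2(n−2))/(n(n+1))` on the `n` bonds touching the home block (`r = 0,…,n−1`, the last one the crossing bond).
[cite: Balaban1985Variational, (8) p.279] -/
def hprof (n r : ℕ) : ℝ := (6 * (r : ℝ) - 2 * ((n : ℝ) - 2)) / ((n : ℝ) * ((n : ℝ) + 1))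

/-- **ITS CUMULATIVE** `g(j) = Σ_{r<j} h(r)`. [cite: Balaban1985Variational, (8) p.279] -/
def Gprof (n j : ℕ) : ℝ := ∑ r ∈ Finset.range j, hprof n r

/-- Closed form of the cumulative: `g(j) = j(3j − 2n + 1)/(n(n+1))` (`n ≥ 1`). [folklore] -/
theorem Gprof_eq {n : ℕ} (hn : 1 ≤ n) : ∀ j : ℕ, Gprof n j = (j : ℝ) * (3 * (j : ℝ) - 2 * (n : ℝ) + 1) / ((n : ℝ) * ((n : ℝ) + 1))
  | 0 => by simp [Gprof]
  | j + 1 => by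
    have hn0 : (0 : ℝ) < n := by exact_mod_cast hn
    have hn' : (0 : ℝ) < (n : ℝ) * ((n : ℝ) + 1) := by positivity
    rw [Gprof, Finset.sum_range_succ, ← Gprof, Gprof_eq hn j, hprof]
    field_simp
    push_cast
    ring

/-- The profile has total mass one: `g(n) = 1`. [folklore] -/
theorem Gprof_self {n : ℕ} (hn : 1 ≤ n) : Gprof n n = 1 := by
  have hn0 : (0 : ℝ) < n := by exact_mod_cast hn
  have hn' : (0 : ℝ) < (n : ℝ) * ((n : ℝ) + 1) := by positivity
  rw [Gprof_eq hn, div_eq_one_iff_eq hn'.ne']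
  ring

/-- `g(j+1) − g(j) = h(j)`. [folklore] -/
theorem Gprof_succ (n j : ℕ) : Gprof n (j + 1) = Gprof n j + hprof n j := by
  rw [Gprof, Finset.sum_range_succ, ← Gprof]

/-- `g(0) = 0`. [folklore] -/
@[simp] theorem Gprof_zero (n : ℕ) : Gprof n 0 = 0 := by simp [Gprof]

/-- **THE CUMULATIVE HAS ZERO BLOCK SUM**: `Σ_{j<m} g(j) = m(m−1)(m−n)/(n(n+1))`, so `Σ_{j<n} g(j) = 0`. [folklore] -/
theorem sum_Gprof_eq {n : ℕ} (hn : 1 ≤ n) : ∀ m : ℕ,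
    ∑ j ∈ Finset.range m, Gprof n j = (m : ℝ) * ((m : ℝ) - 1) * ((m : ℝ) - n) / ((n : ℝ) * ((n : ℝ) + 1))
  | 0 => by simp
  | m + 1 => by
    have hn0 : (0 : ℝ) < n := by exact_mod_cast hn
    have hn' : (0 : ℝ) < (n : ℝ) * ((n : ℝ) + 1) := by positivity
    rw [Finset.sum_range_succ, sum_Gprof_eq hn m, Gprof_eq hn]
    field_simp
    push_cast
    ring

/-- `Σ_{j<n} g(j) = 0`. [folklore] -/
theorem sum_Gprof_self {n : ℕ} (hn : 1 ≤ n) : ∑ j ∈ Finset.range n, Gprof n j = 0 := by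
  rw [sum_Gprof_eq hn]; simp

/-- **BOUND ON THE PROFILE**: `|h(r)| ≤ 4/n` for `r < n`. [folklore] -/
theorem abs_hprof_le {n r : ℕ} (hn : 1 ≤ n) (hr : r < n) : |hprof n r| ≤ 4 / (n : ℝ) := by
  have hn1 : (1 : ℝ) ≤ n := by exact_mod_cast hn
  have hr' : (r : ℝ) + 1 ≤ n := by exact_mod_cast hr
  have hr0 : (0 : ℝ) ≤ r := Nat.cast_nonneg _
  have hn0 : (0 : ℝ) < n := by linarith
  have hpos : (0 : ℝ) < (n : ℝ) * ((n : ℝ) + 1) := by positivity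
  rw [hprof, abs_div, abs_of_pos hpos, div_le_div_iff₀ hpos hn0]
  have hnum : |6 * (r : ℝ) - 2 * ((n : ℝ) - 2)| ≤ 4 * ((n : ℝ) + 1) := by
    rw [abs_le]; constructor <;> nlinarith
  nlinarith [abs_nonneg (6 * (r : ℝ) - 2 * ((n : ℝ) - 2))]

/-- **BOUND ON THE CUMULATIVE**: `|g(j)| ≤ 1` for `j ≤ n`. [folklore] -/
theorem abs_Gprof_le {n j : ℕ} (hn : 1 ≤ n) (hj : j ≤ n) : |Gprof n j| ≤ 1 := by
  have hn1 : (1 : ℝ) ≤ n := by exact_mod_cast hn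
  have hj' : (j : ℝ) ≤ n := by exact_mod_cast hj
  have hj0 : (0 : ℝ) ≤ j := Nat.cast_nonneg _
  have hn0 : (0 : ℝ) < n := by linarith
  have hpos : (0 : ℝ) < (n : ℝ) * ((n : ℝ) + 1) := by positivity
  rw [Gprof_eq hn, abs_div, abs_of_pos hpos, div_le_one hpos, abs_le]
  constructor <;> nlinarith

/-! ## §2 Periodic shapes of the cyclic offset -/

/-- A profile on `[0, N)` read periodically. [folklore] -/
def per (N : ℕ) (F : ℕ → ℝ) : ℕ → ℝ := fun ρ => F (ρ % N)

/-- Periodic shapes agree at congruent arguments. [folklore] -/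
theorem per_congr {N : ℕ} (F : ℕ → ℝ) {a b : ℕ} (h : a % N = b % N) : per N F a = per N F b := by
  simp only [per, h]

/-- **THE CROSSING BOND** out of the home block: `c(ρ) = [ρ mod N = n − 1]`. [cite: Balaban1987RG1, (0.4) p.253] -/
def cS (n N : ℕ) : ℕ → ℝ := per N fun r => if r = n - 1 then 1 else 0

/-- **THE HOME BLOCK**: `b(ρ) = [ρ mod N < n]`. [cite: Balaban1987RG1, (0.3) p.252] -/
def bS (n N : ℕ) : ℕ → ℝ := per N fun r => if r < n then 1 else 0

/-- **THE BOND PROFILE HOSTED IN THE HOME BLOCK** (`θ = 0`) or **IN THE NEXT BLOCK, MIRRORED** (`θ = 1`). [cite: Balaban1985Variational, (8) p.279] -/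
def hS (θ : Bool) (n N : ℕ) : ℕ → ℝ :=
  per N fun r => if θ then (if n - 1 ≤ r ∧ r ≤ 2 * n - 2 then hprof n (2 * n - 2 - r) else 0) else (if r < n then hprof n r else 0)

/-- **THE CUMULATIVE MINUS THE STEP**, hosted with the profile: `g⁰(ρ) = Σ_{r<ρ} h⁰(r) − [ρ ≥ n]` lives in the home block, `g¹` in the next block. [cite: Balaban1985Variational, (8) p.279] -/
def gS (θ : Bool) (n N : ℕ) : ℕ → ℝ :=
  per N fun r => if θ then (if n ≤ r ∧ r < 2 * n then -Gprof n (2 * n - 1 - r) else 0) else (if r < n then Gprof n r else 0)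

/-- **THE SITE SHAPE** of the home block in the base system: `N(ρ) = b(ρ) + g⁰(ρ + n) − g⁰(ρ)` (the second term is the previous block's cumulative). [cite: Balaban1987RG1, (0.3) p.252] -/
def NS (n N : ℕ) : ℕ → ℝ := fun ρ => bS n N ρ + gS false n N (ρ + n) - gS false n N ρ

/-- Congruent arguments, all shapes. [folklore] -/
theorem cS_congr {n N a b : ℕ} (h : a % N = b % N) : cS n N a = cS n N b := per_congr _ h
/-- Congruent arguments, all shapes. [folklore] -/
theorem bS_congr {n N a b : ℕ} (h : a % N = b % N) : bS n N a = bS n N b := per_congr _ h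
/-- Congruent arguments, all shapes. [folklore] -/
theorem hS_congr (θ : Bool) {n N a b : ℕ} (h : a % N = b % N) : hS θ n N a = hS θ n N b := per_congr _ h
/-- Congruent arguments, all shapes. [folklore] -/
theorem gS_congr (θ : Bool) {n N a b : ℕ} (h : a % N = b % N) : gS θ n N a = gS θ n N b := per_congr _ h
/-- Congruent arguments, all shapes. [folklore] -/
theorem NS_congr {n N a b : ℕ} (h : a % N = b % N) : NS n N a = NS n N b := by
  unfold NS
  rw [bS_congr h, gS_congr false h, gS_congr false (a := a + n) (b := b + n) (by rw [Nat.add_mod, h, ← Nat.add_mod])]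

/-! ## §3 The difference relations -/

section Relations

variable {n N nc : ℕ} (hN : N = n * nc) (hnc : 2 ≤ nc) (hn : 1 ≤ n)
include hN hnc hn

omit hn in
/-- `2n ≤ N`. [folklore] -/
theorem two_n_le : 2 * n ≤ N := by rw [hN, mul_comm]; exact Nat.mul_le_mul_left _ hnc

/-- The successor of the offset: `(ρ+1) mod N` is `ρ mod N + 1` unless that is `N`, in which case it is `0`. [folklore] -/
theorem succ_mod (ρ : ℕ) : ((ρ + 1) % N = ρ % N + 1 ∧ ρ % N + 1 < N) ∨ ((ρ + 1) % N = 0 ∧ ρ % N + 1 = N) := by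
  have h2n := two_n_le hN hnc
  have hN0 : 0 < N := by omega
  have hlt : ρ % N < N := Nat.mod_lt _ hN0
  rcases Nat.lt_or_ge (ρ % N + 1) N with h | h
  · left; refine ⟨?_, h⟩
    rw [Nat.add_mod, Nat.one_mod_eq_one.mpr (by omega), Nat.mod_eq_of_lt h]
  · right
    have heq : ρ % N + 1 = N := by omega
    refine ⟨?_, heq⟩
    rw [Nat.add_mod, Nat.one_mod_eq_one.mpr (by omega), heq, Nat.mod_self]

omit hN hnc in
/-- `g(n) = g(n−1) + h(n−1)` read with `g(n) = 1`: `−g(n−1) = h(n−1) − 1`. [folklore] -/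
theorem neg_Gprof_pred : -Gprof n (n - 1) = hprof n (n - 1) - 1 := by
  have e : n - 1 + 1 = n := by omega
  have h3 := Gprof_succ n (n - 1)
  rw [e, Gprof_self hn] at h3
  linarith

/-- **★ `g⁰(ρ+1) − g⁰(ρ) = h⁰(ρ) − c(ρ)`** (the home-hosted cumulative jumps down by one at the crossing bond). [cite: Balaban1985Variational, (8) p.279] -/
theorem gS_false_succ_sub (ρ : ℕ) : gS false n N (ρ + 1) - gS false n N ρ = hS false n N ρ - cS n N ρ := by
  have h2n := two_n_le hN hnc
  have key := neg_Gprof_pred hn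
  simp only [gS, hS, cS, per, Bool.false_eq_true, if_false]
  rcases succ_mod hN hnc hn ρ with ⟨hs, hlt⟩ | ⟨hs, heq⟩
  · rw [hs]
    set r := ρ % N
    by_cases h1 : r + 1 < n
    · simp only [h1, show r < n from by omega, show ¬ (r = n - 1) from by omega, ↓reduceIte, Gprof_succ]
      ring
    · by_cases h2 : r + 1 = n
      · have hr : r = n - 1 := by omega
        have hc : (if r = n - 1 then (1 : ℝ) else 0) = 1 := if_pos hr
        simp only [h1, show r < n from by omega, hc, ↓reduceIte]
        rw [hr]; linarith
      · simp only [h1, show ¬ (r < n) from by omega, show ¬ (r = n - 1) from by omega, ↓reduceIte]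
  · rw [hs]
    set r := ρ % N
    simp only [show 0 < n from by omega, show ¬ (r < n) from by omega, show ¬ (r = n - 1) from by omega, ↓reduceIte, Gprof_zero]

/-- **★ `g¹(ρ+1) − g¹(ρ) = h¹(ρ) − c(ρ)`** (the mirrored cumulative hosted in the next block). [cite: Balaban1985Variational, (8) p.279] -/
theorem gS_true_succ_sub (ρ : ℕ) : gS true n N (ρ + 1) - gS true n N ρ = hS true n N ρ - cS n N ρ := by
  have h2n := two_n_le hN hnc
  have key := neg_Gprof_pred hn
  simp only [gS, hS, cS, per, if_true]
  rcases succ_mod hN hnc hn ρ with ⟨hs, hlt⟩ | ⟨hs, heq⟩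
  · rw [hs]
    set r := ρ % N
    by_cases h1 : r + 1 < n
    · simp only [show ¬ (n ≤ r + 1) from by omega, show ¬ (n ≤ r) from by omega, show ¬ (n - 1 ≤ r) from by omega,
        show ¬ (r = n - 1) from by omega, false_and, ↓reduceIte]
    · by_cases h2 : r + 1 = n
      · have e1 : 2 * n - 1 - (r + 1) = n - 1 := by omega
        have e2 : 2 * n - 2 - r = n - 1 := by omega
        have hc : (if r = n - 1 then (1 : ℝ) else 0) = 1 := if_pos (by omega)
        simp only [show n ≤ r + 1 from by omega, show r + 1 < 2 * n from by omega, show ¬ (n ≤ r) from by omega, show n - 1 ≤ r from by omega,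
          show r ≤ 2 * n - 2 from by omega, hc, and_self, false_and, ↓reduceIte, e1, e2]
        linarith
      · by_cases h3 : r + 1 < 2 * n
        · -- inside the next block: `n ≤ r`, `r + 1 ≤ 2n − 1`
          have e1 : 2 * n - 1 - r = (2 * n - 1 - (r + 1)) + 1 := by omega
          have e2 : 2 * n - 2 - r = 2 * n - 1 - (r + 1) := by omega
          simp only [show n ≤ r + 1 from by omega, h3, show n ≤ r from by omega, show r < 2 * n from by omega, show n - 1 ≤ r from by omega,
            show r ≤ 2 * n - 2 from by omega, show ¬ (r = n - 1) from by omega, and_self, ↓reduceIte, e1, e2, Gprof_succ]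
          ring
        · by_cases h4 : r + 1 = 2 * n
          · have e1 : 2 * n - 1 - r = 0 := by omega
            simp only [h3, show n ≤ r from by omega, show r < 2 * n from by omega, show ¬ (r ≤ 2 * n - 2) from by omega,
              show ¬ (r = n - 1) from by omega, and_self, and_false, ↓reduceIte, e1, Gprof_zero]
            ring
          · simp only [h3, show ¬ (r < 2 * n) from by omega, show ¬ (r ≤ 2 * n - 2) from by omega, show ¬ (r = n - 1) from by omega,
              and_false, ↓reduceIte]
  · rw [hs]
    set r := ρ % N
    by_cases h5 : r < 2 * n
    · have e1 : 2 * n - 1 - r = 0 := by omega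
      simp only [show ¬ (n ≤ 0) from by omega, show n ≤ r from by omega, h5, show ¬ (r ≤ 2 * n - 2) from by omega,
        show ¬ (r = n - 1) from by omega, false_and, and_self, and_false, ↓reduceIte, e1, Gprof_zero]
      ring
    · simp only [show ¬ (n ≤ 0) from by omega, h5, show ¬ (r ≤ 2 * n - 2) from by omega, show ¬ (r = n - 1) from by omega,
        false_and, and_false, ↓reduceIte]

/-- Both hostings at once. [cite: Balaban1985Variational, (8) p.279] -/
theorem gS_succ_sub (θ : Bool) (ρ : ℕ) : gS θ n N (ρ + 1) - gS θ n N ρ = hS θ n N ρ - cS n N ρ := by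
  cases θ
  · exact gS_false_succ_sub hN hnc hn ρ
  · exact gS_true_succ_sub hN hnc hn ρ

/-- The crossing bond INTO the home block, read from the home offset: `c(ρ + n) = [ρ mod N = N − 1]`. [folklore] -/
theorem cS_add_n (ρ : ℕ) : cS n N (ρ + n) = if ρ % N = N - 1 then 1 else 0 := by
  have h2n := two_n_le hN hnc
  have hN0 : 0 < N := by omega
  simp only [cS, per]
  have hlt : ρ % N < N := Nat.mod_lt _ hN0
  rw [Nat.add_mod, Nat.mod_eq_of_lt (show n < N by omega)]
  by_cases h : ρ % N + n < N
  · simp only [Nat.mod_eq_of_lt h, show ¬ (ρ % N + n = n - 1) from by omega, show ¬ (ρ % N = N - 1) from by omega, ↓reduceIte]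
  · rw [Nat.mod_eq_sub_mod (by omega), Nat.mod_eq_of_lt (by omega)]
    by_cases h' : ρ % N = N - 1
    · rw [if_pos (show ρ % N + n - N = n - 1 from by omega), if_pos h']
    · rw [if_neg (show ¬ (ρ % N + n - N = n - 1) from by omega), if_neg h']

/-- **★ `b(ρ+1) − b(ρ) = c(ρ+n) − c(ρ)`** (the block indicator rises at the crossing into the block and falls at the crossing out of it). [cite: Balaban1987RG1, (0.3) p.252] -/
theorem bS_succ_sub (ρ : ℕ) : bS n N (ρ + 1) - bS n N ρ = cS n N (ρ + n) - cS n N ρ := by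
  have h2n := two_n_le hN hnc
  rw [cS_add_n hN hnc hn]
  simp only [bS, cS, per]
  rcases succ_mod hN hnc hn ρ with ⟨hs, hlt⟩ | ⟨hs, heq⟩
  · rw [hs]
    set r := ρ % N
    by_cases h1 : r + 1 < n
    · simp only [h1, show r < n from by omega, show ¬ (r = N - 1) from by omega, show ¬ (r = n - 1) from by omega, ↓reduceIte]
      ring
    · by_cases h2 : r + 1 = n
      · have hc : (if r = n - 1 then (1 : ℝ) else 0) = 1 := if_pos (by omega)
        simp only [h1, show r < n from by omega, show ¬ (r = N - 1) from by omega, hc, ↓reduceIte]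
      · simp only [h1, show ¬ (r < n) from by omega, show ¬ (r = N - 1) from by omega, show ¬ (r = n - 1) from by omega, ↓reduceIte]
  · rw [hs]
    set r := ρ % N
    have hc : (if r = N - 1 then (1 : ℝ) else 0) = 1 := if_pos (by omega)
    simp only [show 0 < n from by omega, show ¬ (r < n) from by omega, hc, show ¬ (r = n - 1) from by omega,
      ↓reduceIte]

/-- `N(ρ+1) − N(ρ) = h⁰(ρ+n) − h⁰(ρ)` (the Whitney relation of the base site shape). [cite: Balaban1987RG1, (0.3) p.252] -/
theorem NS_succ_sub (ρ : ℕ) : NS n N (ρ + 1) - NS n N ρ = hS false n N (ρ + n) - hS false n N ρ := by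
  have h1 := bS_succ_sub hN hnc hn ρ
  have h2 := gS_false_succ_sub hN hnc hn ρ
  have h3 := gS_false_succ_sub hN hnc hn (ρ + n)
  simp only [NS]
  rw [show ρ + 1 + n = ρ + n + 1 by ring]
  linarith

end Relations

end Summit.QuantumFields.YangMills.Theorems.AbelianEML.Shapes1D

end
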